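import Mathlib
import HarnessLib
import Literature.MathematicalPhysics.QuantumLattice.OnSitePairingAlgebra
import Literature.MathematicalPhysics.QuantumLattice.HubbardOneParticleCost

/-!
# Route `ThermalWedge`, item `stmt-HubbardSuperconductivity-1702` (`TwPureThermalBound`):
# the sector energies of the repulsive Hubbard model are Lipschitz in the particle number — part 1
# (orbit-sum identity, sector ground states)

Support file (`--supports stmt-HubbardSuperconductivity-1702`; no definition). For the Hubbard
Hamiltonian `H = H(t,U)` (`hamiltonian G t U`, `U ≥ 0`) on ANY finite graph and its sector energies
`E(K) = groundEnergyAt G t U K`: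

* (part 2) `ptb_mul_groundEnergyAt_pred_le`: **`K · E(K−1) ≤ (K−1) · E(K)`** for `1 ≤ K ≤ 2|Λ|`. Proof: for a
  `K`-particle ground state `ψ` the `2|Λ|` vectors `c_oψ` are `(K−1)`-particle trial states of total
  weight `Σ_o ‖c_oψ‖² = K` and total energy `Σ_o ⟨c_oψ, H c_oψ⟩ = (K−1)E(K) − U⟨ψ, Dψ⟩ ≤ (K−1)E(K)`,
  by the operator identity `Σ_o c†_o [H, c_o] = −H − U D` (`D = Σ_x n_{x↑}n_{x↓}`;
  `[c†_a c_b, c_o] = −δ_{ao} c_b`, `[n_a n_b, c_o] = −δ_{bo} n_a c_b − δ_{ao} c_a n_b`).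
* `ptb_neg_le_groundEnergyAt`: on a graph of maximal degree `≤ Δ`, **`E(K) ≥ −Δ|t|K`**
  (`2Re⟨c_xψ, c_yψ⟩ ≤ ‖c_xψ‖² + ‖c_yψ‖²`, `Σ_{x,σ} deg(x)‖c_{xσ}ψ‖² ≤ ΔK`, interaction `≥ 0`).
* Hence `E(K−1) ≤ E(K) + Δ|t|` (`ptb_groundEnergyAt_pred_le`) and, on graphs with a bipartite sign,
  by particle–hole symmetry (`groundEnergyAt_particleHole`) `E(K+1) ≤ E(K) + Δ|t| + U`
  (`ptb_groundEnergyAt_succ_le`): **`|E(K) − E(K')| ≤ (Δ|t| + U)|K − K'|`** (`ptb_abs_groundEnergyAt_sub_le`).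

These are the finite-volume continuity estimates in the density that the thermodynamic limit of the
canonical ground-state energy density (Ruelle, *Statistical Mechanics* (1969) §3; for the item: the
`T = 0` equivalence of ensembles behind `TwPureThermalBound`) needs. Everything is folklore
finite-dimensional algebra in the Jordan–Wigner representation (Bratteli–Robinson II §5.2.2).
-/

set_option linter.dupNamespace false

noncomputable section

namespace Summit.HubbardSuperconductivity.HubbardSuperconductivity.Theorems

open Literature.MathematicalPhysics.QuantumLattice Literature.Probability.LatticeModels Matrix Finset
open scoped ComplexOrder

/-! ### Commutators of the Hubbard terms with an annihilation operator -/

section Operators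

variable {ι : Type*} [LinearOrder ι] [Fintype ι]

/-- **`[c†_a c_b, c_o] = −δ_{ao} c_b`.** [folklore] -/
theorem ptb_hop_comm_annihilation (a b o : ι) :
    creation a * annihilation b * annihilation o - annihilation o * (creation a * annihilation b) =
      -(if a = o then annihilation b else 0) := by
  rw [← mul_assoc, annihilation_mul_creation o a]
  by_cases h : a = o
  · subst h
    rw [if_pos rfl, if_pos rfl, sub_mul, one_mul, mul_assoc, LiebThm1.annihilation_mul_annihilation_eq_neg b a,
      mul_neg, mul_assoc]
    abel
  · rw [if_neg (Ne.symm h), if_neg h, zero_sub, neg_mul, mul_assoc,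
      LiebThm1.annihilation_mul_annihilation_eq_neg b o, mul_neg, mul_assoc, neg_zero]
    abel

/-- **`[n_a, c_o] = −δ_{ao} c_a`.** [folklore] -/
theorem ptb_numberAt_comm_annihilation (a o : ι) :
    numberAt a * annihilation o - annihilation o * numberAt a = -(if a = o then annihilation a else 0) := by
  by_cases h : a = o
  · subst h
    rw [if_pos rfl, numberAt_mul_annihilation_self, annihilation_mul_numberAt_self, zero_sub]
  · rw [if_neg h, numberAt_mul_annihilation_of_ne h, sub_self, neg_zero]

/-- **`[n_a n_b, c_o] = −δ_{bo} n_a c_b − δ_{ao} c_a n_b`.** [folklore] -/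
theorem ptb_numberAt_mul_numberAt_comm_annihilation (a b o : ι) :
    numberAt a * numberAt b * annihilation o - annihilation o * (numberAt a * numberAt b) =
      -(if b = o then numberAt a * annihilation b else 0) - (if a = o then annihilation a * numberAt b else 0) := by
  have h1 := ptb_numberAt_comm_annihilation b o
  have h2 := ptb_numberAt_comm_annihilation a o
  calc numberAt a * numberAt b * annihilation o - annihilation o * (numberAt a * numberAt b)
      = numberAt a * (numberAt b * annihilation o - annihilation o * numberAt b) +
          (numberAt a * annihilation o - annihilation o * numberAt a) * numberAt b := by noncomm_ring
    _ = _ := by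
        rw [h1, h2]
        split_ifs <;> noncomm_ring

/-- `c†_o δ_{ao} X = δ_{ao} c†_a X` summed over `o`. [folklore] -/
theorem ptb_sum_creation_mul_ite (a : ι) (X : Matrix (Finset ι) (Finset ι) ℂ) :
    ∑ o : ι, creation o * (if a = o then X else 0) = creation a * X := by
  rw [Finset.sum_eq_single a]
  · rw [if_pos rfl]
  · intro o _ ho; rw [if_neg (Ne.symm ho), mul_zero]
  · intro h; exact absurd (Finset.mem_univ a) h

/-- **`Σ_o c†_o [c†_a c_b, c_o] = −c†_a c_b`.** [folklore] -/
theorem ptb_sum_creation_hop_comm (a b : ι) :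
    ∑ o : ι, creation o * (creation a * annihilation b * annihilation o - annihilation o * (creation a * annihilation b)) =
      -(creation a * annihilation b) := by
  simp_rw [ptb_hop_comm_annihilation, mul_neg, Finset.sum_neg_distrib, ptb_sum_creation_mul_ite]

/-- **`Σ_o c†_o [n_a n_b, c_o] = −2 n_a n_b`** for `a ≠ b`. [folklore] -/
theorem ptb_sum_creation_nn_comm {a b : ι} (hab : a ≠ b) :
    ∑ o : ι, creation o * (numberAt a * numberAt b * annihilation o - annihilation o * (numberAt a * numberAt b)) =
      -(2 : ℂ) • (numberAt a * numberAt b) := by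
  simp_rw [ptb_numberAt_mul_numberAt_comm_annihilation, mul_sub, mul_neg, Finset.sum_sub_distrib,
    Finset.sum_neg_distrib, ptb_sum_creation_mul_ite]
  -- `c†_b n_a c_b = n_a n_b` and `c†_a c_a n_b = n_a n_b`
  have hc : numberAt a * creation b = creation b * numberAt a := number_mul_creation_of_ne hab
  have h1 : creation b * (numberAt a * annihilation b) = numberAt a * numberAt b := by
    rw [← mul_assoc, ← hc, mul_assoc]; rfl
  have h2 : creation a * (annihilation a * numberAt b) = numberAt a * numberAt b := by
    rw [numberAt, numberAt]; noncomm_ring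
  rw [h1, h2, neg_smul, two_smul, neg_add, sub_eq_add_neg]

end Operators

/-! ### The Hubbard Hamiltonian: `Σ_o c†_o [H, c_o] = −H − U D` -/

section Hamiltonian

variable {Λ : Type*} [LinearOrder Λ] [Fintype Λ] (G : SimpleGraph Λ) [DecidableRel G.Adj]

/-- **`Σ_o c†_o [H(t,U), c_o] = −H(t,U) − U Σ_x n_{x↑}n_{x↓}`.** [folklore] -/
theorem ptb_sum_creation_hamiltonian_comm (t U : ℝ) :
    ∑ o : Orb Λ, creation o * (hamiltonian G t U * annihilation o - annihilation o * hamiltonian G t U) =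
      -hamiltonian G t U - (U : ℂ) • ∑ x : Λ, numberOp x 0 * numberOp x 1 := by
  have hlin : ∀ o : Orb Λ, hamiltonian G t U * annihilation o - annihilation o * hamiltonian G t U =
      -(t : ℂ) • (∑ x : Λ, ∑ y : Λ, ∑ σ : Fin 2, if G.Adj x y then
        (creation (orb x σ) * annihilation (orb y σ) * annihilation o -
          annihilation o * (creation (orb x σ) * annihilation (orb y σ))) else 0) +
      (U : ℂ) • ∑ x : Λ, (numberAt (orb x 0) * numberAt (orb x 1) * annihilation o -
          annihilation o * (numberAt (orb x 0) * numberAt (orb x 1))) := by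
    intro o
    unfold hamiltonian
    simp only [add_mul, mul_add, smul_mul_assoc, mul_smul_comm, Finset.sum_mul, Finset.mul_sum,
      numberAt_orb]
    rw [add_sub_add_comm, ← smul_sub, ← smul_sub, ← Finset.sum_sub_distrib, ← Finset.sum_sub_distrib]
    congr 2
    · refine Finset.sum_congr rfl fun x _ => ?_
      rw [← Finset.sum_sub_distrib]
      refine Finset.sum_congr rfl fun y _ => ?_
      rw [← Finset.sum_sub_distrib]
      refine Finset.sum_congr rfl fun σ _ => ?_
      split_ifs <;> simp
  simp_rw [hlin, mul_add, mul_smul_comm, Finset.mul_sum, Finset.sum_add_distrib, ← Finset.smul_sum]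
  have hhop : ∑ o : Orb Λ, ∑ x : Λ, ∑ y : Λ, ∑ σ : Fin 2, creation o *
      (if G.Adj x y then creation (orb x σ) * annihilation (orb y σ) * annihilation o -
        annihilation o * (creation (orb x σ) * annihilation (orb y σ)) else 0) =
      -∑ x : Λ, ∑ y : Λ, ∑ σ : Fin 2, if G.Adj x y then creation (orb x σ) * annihilation (orb y σ) else 0 := by
    rw [Finset.sum_comm, ← Finset.sum_neg_distrib]
    refine Finset.sum_congr rfl fun x _ => ?_
    rw [Finset.sum_comm, ← Finset.sum_neg_distrib]
    refine Finset.sum_congr rfl fun y _ => ?_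
    rw [Finset.sum_comm, ← Finset.sum_neg_distrib]
    refine Finset.sum_congr rfl fun σ _ => ?_
    split_ifs
    · rw [ptb_sum_creation_hop_comm]
    · simp
  have hint : ∑ o : Orb Λ, ∑ x : Λ, creation o * (numberAt (orb x 0) * numberAt (orb x 1) * annihilation o -
      annihilation o * (numberAt (orb x 0) * numberAt (orb x 1))) =
      -(2 : ℂ) • ∑ x : Λ, numberOp x 0 * numberOp x 1 := by
    rw [Finset.sum_comm, Finset.smul_sum]
    refine Finset.sum_congr rfl fun x _ => ?_
    have hne : orb x 0 ≠ orb x 1 := by simp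
    rw [ptb_sum_creation_nn_comm hne]
    rfl
  rw [hhop, hint]
  unfold hamiltonian
  module

/-- **The sum over orbitals of the energies of the `(K−1)`-particle vectors `c_oψ`**: for a
`K`-particle eigenvector `Hψ = Eψ`,
`Σ_o ⟨c_oψ, H c_oψ⟩ = (K−1)E⟨ψ,ψ⟩ − U⟨ψ, Dψ⟩`. [folklore] -/
theorem ptb_sum_expect_annihilation (t U : ℝ) {K : ℕ} {ψ : Fock (Orb Λ)} (hψ : IsNParticle K ψ) {E : ℂ}
    (hE : hamiltonian G t U *ᵥ ψ = E • ψ) :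
    ∑ o : Orb Λ, star (annihilation o *ᵥ ψ) ⬝ᵥ (hamiltonian G t U *ᵥ (annihilation o *ᵥ ψ)) =
      ((K : ℂ) - 1) * E * (star ψ ⬝ᵥ ψ) -
        (U : ℂ) * (star ψ ⬝ᵥ ((∑ x : Λ, numberOp x 0 * numberOp x 1) *ᵥ ψ)) := by
  have hterm : ∀ o : Orb Λ, star (annihilation o *ᵥ ψ) ⬝ᵥ (hamiltonian G t U *ᵥ (annihilation o *ᵥ ψ)) =
      star ψ ⬝ᵥ ((creation o * (hamiltonian G t U * annihilation o - annihilation o * hamiltonian G t U)) *ᵥ ψ) +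
        E * (star ψ ⬝ᵥ (numberAt o *ᵥ ψ)) := by
    intro o
    rw [ThermodynamicLimit.star_mulVec_dotProduct, annihilation_conjTranspose, mulVec_mulVec, mulVec_mulVec]
    have : creation o * hamiltonian G t U * annihilation o =
        creation o * (hamiltonian G t U * annihilation o - annihilation o * hamiltonian G t U) +
          numberAt o * hamiltonian G t U := by
      rw [numberAt]; noncomm_ring
    rw [this, add_mulVec, dotProduct_add, ← mulVec_mulVec ψ (numberAt o) (hamiltonian G t U), hE, mulVec_smul,
      dotProduct_smul, smul_eq_mul]
  simp_rw [hterm, Finset.sum_add_distrib, ← dotProduct_sum, ← Matrix.sum_mulVec, ptb_sum_creation_hamiltonian_comm,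
    ← Finset.mul_sum, ← dotProduct_sum, ← Matrix.sum_mulVec]
  have hN : (∑ o : Orb Λ, numberAt o) *ᵥ ψ = (K : ℂ) • ψ := by
    rw [show (∑ o : Orb Λ, numberAt o) = totalNumberOp from rfl, totalNumberOp_eq_totalNumber,
      totalNumber_mulVec_of_isNParticle hψ]
  rw [hN, dotProduct_smul, sub_mulVec, neg_mulVec, hE, smul_mulVec, dotProduct_sub, dotProduct_neg,
    dotProduct_smul, dotProduct_smul, smul_eq_mul, smul_eq_mul, smul_eq_mul]
  ring

end Hamiltonian

/-! ### Ground states in a particle-number sector and the two one-sided Lipschitz bounds -/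

section Sector

variable {Λ : Type*} [LinearOrder Λ] [Fintype Λ] (G : SimpleGraph Λ) [DecidableRel G.Adj]

end Sector

end Summit.HubbardSuperconductivity.HubbardSuperconductivity.Theorems

end
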